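import Literature.NumberTheory.Sieve.MontgomeryVaughan1975Lemma43Terms
import Literature.NumberTheory.Sieve.MontgomeryVaughan1975Lemma43ZeroSums
import Literature.NumberTheory.Sieve.MontgomeryVaughan1975Lemma43Ranges
import Literature.NumberTheory.Sieve.MontgomeryVaughan1975Lemma43
import HarnessLib

/-!
# Montgomery–Vaughan (1975), LEMMA 4.3 (= Gallagher's Theorem 7, modified) from the truncated
explicit formulae and a log-free zero-density estimate with the Deuring–Heilbronn factor —
PROVED assembly

H. L. Montgomery, R. C. Vaughan, *The exceptional set in Goldbach's problem*, Acta Arith. 27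
(1975) 353–370 [MontgomeryVaughanActa1975], §4, Lemma 4.3, p. 357–358: "This is Theorem 7 of
Gallagher [5], with two modifications. Firstly we have replaced Gallagher's … by `max max`;
this is easily justified by an examination of Gallagher's proof. Secondly, … we take `T = P⁶` and
appeal to (4.1) in place of Siegel's theorem"; P. X. Gallagher, *A large sieve density estimate
near `σ = 1`*, Invent. Math. 11 (1970) 329–339, §5 (Theorem 7 from Theorem 6).

`lemma43At_of_explicitFormula_of_density`: the tree's `lemma43At c₁` (the body of the named fact
`lemma43_gallagher`) for every `c₁` below an absolute constant, FROM
* the truncated explicit formulae MV I Thm 12.10 and Thm 12.5 — the existing named facts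
  `Literature.NumberTheory.LFunctions.truncatedExplicitFormula_psiChar`,
  `Literature.NumberTheory.LFunctions.truncatedExplicitFormula_psi`, taken as hypotheses;
* a LOG-FREE ZERO-DENSITY ESTIMATE for the family `χ` primitive mod `q ≤ P`, height `P⁶`
  (Gallagher 1970 Thm 6; Bombieri, *Le grand crible* Thm 14): `∑_q ∑*_χ N(α, P⁶, χ) ≤ C_D P^{c_D(1−α)}`
  for `0 ≤ α ≤ 1`, and the same sum WITHOUT the exceptional zero bounded by
  `C_D (1 − β̃)(log P) P^{c_D(1−α)}` when an exceptional zero `β̃` at level `c_H` exists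
  (Bombieri Thm 14, second part: the Deuring–Heilbronn factor) — stated as explicit hypotheses
  (binders), in the currency `lfunctionZeroBox`/`DirichletDisc.zeroOrder` for `q ≥ 2` and
  `weilZeroIndex`/`riemannZetaZeroOrder` for `ζ`, over arbitrary finite sets of zeros in the boxes.
Everything else is PROVED in the tree: the zero-free regions and Page's theorem in the box
(`MontgomeryVaughan1975BoxZeros`), simplicity of `β̃`, Siegel's theorem for `1 − β̃`
(`Literature.NumberTheory.LFunctions.Siegel.exists_one_sub_realZero_ge`, in place of the
effective (4.1)), the block estimates (`…Lemma43Blocks`), the weighted terms (`…Lemma43Terms`), the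
density lemma (`…Lemma43Tools`, `…Lemma43ZeroSums`) and the ranges (`…Lemma43Ranges`).

## The argument (Gallagher §5 in M–V's setting)

Fix `c = min(c_b/10, c_z/10, c_s/2, c_P/2, c_H, 1/2)` (box, `ζ`-box, simplicity, Page, D–H
constants). By `lemma43At_anti` it suffices to prove `lemma43At c`. Take `c₃ = c`,
`c₄ = min(1/20, 1/(6 + 2c_D))`, `T = P⁶`, `u₀ = ⌈N/P⁵⌉`. For `N ≥ 2` the range forces
`log N ≥ 1/c₄²`, `P ≥ e^{20}`. Each weighted term is `≤ ∑_ρ m(ρ) u₀^{β−1} + (P/N)(trivial + E)`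
(`…Terms`); summing over the `≤ P²` pairs `(q, χ)`, the errors total `≤ M₀/P²`
(`error_budget_le`), and the zero sums total `≤ 10 C_D (B/u₀)^η ≤ 10 C_D e^{c(5+c_D)} e^{−c log N/log P}`
(`B = P^{c_D}`, `η = c/log P`: every zero other than `β̃` has `β ≤ 1 − c/log P` by the box lemma
and uniqueness). In the exceptional case the density carries the factor `(1 − β̃) log P` and
`M₀/P² ≤ (2M₀/C_S)(1 − β̃)(log P) e^{−cL}` by Siegel's bound `1 − β̃ ≥ C_S r̃^{−1/8}`.
-/

noncomputable section

open Finset Real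

namespace Literature.NumberTheory.Sieve.MontgomeryVaughan1975

open Literature.NumberTheory.LFunctions
open Literature.NumberTheory.LFunctions.Siegel (exists_one_sub_realZero_ge)

/-! ### Counting pairs `(q, χ)` and reindexing the moduli -/

open scoped Classical in
/-- At most `q` primitive characters mod `q` (`φ(q) ≤ q`). [folklore] -/
theorem card_filter_isPrimitive_le_self (q : ℕ) [NeZero q] :
    (((univ : Finset (DirichletCharacter ℂ q)).filter fun χ => χ.IsPrimitive).card : ℝ) ≤ q := by
  have h1 : ((univ : Finset (DirichletCharacter ℂ q)).filter fun χ => χ.IsPrimitive).card ≤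
      Fintype.card (DirichletCharacter ℂ q) := (card_filter_le _ _).trans card_univ.le
  have h2 : Fintype.card (DirichletCharacter ℂ q) = q.totient := by
    rw [← Nat.card_eq_fintype_card]
    exact DirichletCharacter.card_eq_totient_of_hasEnoughRootsOfUnity ℂ q
  have h3 : q.totient ≤ q := Nat.totient_le q
  exact_mod_cast h1.trans (h2 ▸ h3)

/-- `∑_{q=1}^{n} F(q) = F(1) + ∑_{q'=1}^{n-1} F(q'+1)`. [folklore] -/
theorem sum_Icc_one_eq (F : ℕ → ℝ) {n : ℕ} (hn : 1 ≤ n) :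
    ∑ q ∈ Icc 1 n, F q = F 1 + ∑ q' ∈ Ico 1 n, F (q' + 1) := by
  rw [← Finset.Ico_add_one_right_eq_Icc, Finset.sum_eq_sum_Ico_succ_bot (by omega : 1 < n + 1),
    Finset.sum_Ico_add' F 1 n 1]

/-- `∑_{q'=1}^{n-1} (q'+1) ≤ P²` for `n ≤ P`. [folklore] -/
theorem sum_Ico_succ_le_sq {n : ℕ} {P : ℝ} (hn : (n : ℝ) ≤ P) :
    ∑ q' ∈ Ico 1 n, ((q' : ℝ) + 1) ≤ P ^ 2 := by
  have hP0 : 0 ≤ P := le_trans (Nat.cast_nonneg n) hn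
  have h1 : ∀ q' ∈ Ico 1 n, ((q' : ℝ) + 1) ≤ P := by
    intro q' hq'
    rw [Finset.mem_Ico] at hq'
    have : (q' : ℝ) + 1 ≤ n := by exact_mod_cast hq'.2
    linarith
  calc ∑ q' ∈ Ico 1 n, ((q' : ℝ) + 1) ≤ (Ico 1 n).card • P := Finset.sum_le_card_nsmul _ _ _ h1
    _ = ((n - 1 : ℕ) : ℝ) * P := by rw [Nat.card_Ico, nsmul_eq_mul]
    _ ≤ P * P := by
        apply mul_le_mul_of_nonneg_right _ hP0
        have : ((n - 1 : ℕ) : ℝ) ≤ n := by exact_mod_cast Nat.sub_le n 1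
        linarith
    _ = P ^ 2 := (sq P).symm

/-- Transport of an exceptional datum along an identification of characters (same modulus,
same values on `ℕ`). [folklore] -/
theorem IsExceptionalZero.transport {c P : ℝ} {r : ℕ} [NeZero r] {χe : DirichletCharacter ℂ r}
    {β : ℝ} (h : IsExceptionalZero c P r χe β) {q : ℕ} [NeZero q] {χ : DirichletCharacter ℂ q}
    (hqr : q = r) (hχ : ∀ n : ℕ, χ (n : ZMod q) = χe (n : ZMod r)) :
    IsExceptionalZero c P q χ β := by
  subst hqr
  have hχeq : χ = χe := MulChar.ext' fun a => by
    have ha : ((a.val : ℕ) : ZMod q) = a := ZMod.natCast_zmod_val a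
    rw [← ha, hχ a.val]
  subst hχeq
  exact h

/-! ### The assembly -/

-- one long assembly proof with a large context: the default heartbeat budget is too small for
-- its `linarith` calls
set_option maxHeartbeats 1000000 in
open scoped Classical in
/-- **LEMMA 4.3 of Montgomery–Vaughan 1975 (Gallagher's Theorem 7, modified) from the explicit
formulae and a log-free zero-density estimate.** Assume (i) MV I Theorem 12.10
(`truncatedExplicitFormula_psiChar`) and Theorem 12.5 (`truncatedExplicitFormula_psi`); (ii) the
log-free zero-density estimate at height `P⁶` for `ζ` and for the primitive `χ` mod `q`,
`2 ≤ q ≤ P`: for `0 ≤ α ≤ 1` and any finite sets of zeros in the boxes,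
`∑ m(ρ : Re ρ ≥ α) ≤ C_D P^{c_D(1−α)}`; (iii) the same sums without the exceptional zero `β̃`
bounded by `C_D (1 − β̃)(log P) P^{c_D(1−α)}` whenever `(r̃, χ̃, β̃)` is exceptional at level `c_H`
(the Deuring–Heilbronn factor). Then there is an absolute `c > 0` such that `lemma43At c₁` holds for
every `0 < c₁ ≤ c`, i.e. (4.2) with its exceptional clause.
[cite: MontgomeryVaughanActa1975, §4 Lemma 4.3 (4.2)] [cite: Gallagher1970, Theorem 7] -/
theorem lemma43At_of_explicitFormula_of_density
    (hEF : truncatedExplicitFormula_psiChar) (hEFζ : truncatedExplicitFormula_psi)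
    {c_D C_D cH : ℝ} (hcD : 0 < c_D) (hCD : 0 < C_D) (hcH : 0 < cH)
    (hZDζ : ∀ P : ℝ, 2 ≤ P → ∀ α : ℝ, 0 ≤ α → α ≤ 1 →
      ∑ ρ ∈ (weilZeroIndex_finite (P ^ 6)).toFinset with α ≤ ρ.re,
        ((riemannZetaZeroOrder ρ : ℤ) : ℝ) ≤ C_D * P ^ (c_D * (1 - α)))
    (hZD : ∀ P : ℝ, 2 ≤ P → ∀ Z : (q : ℕ) → DirichletCharacter ℂ q → Finset ℂ,
      (∀ (q' : ℕ) (χ : DirichletCharacter ℂ (q' + 1)), ∀ ρ ∈ Z (q' + 1) χ,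
          χ.LFunction ρ = 0 ∧ 0 < ρ.re ∧ ρ.re < 1 ∧ |ρ.im| ≤ P ^ 6) →
      ∀ α : ℝ, 0 ≤ α → α ≤ 1 →
        ∑ q' ∈ Finset.Ico 1 ⌊P⌋₊, ∑ χ : DirichletCharacter ℂ (q' + 1) with χ.IsPrimitive,
          ∑ ρ ∈ Z (q' + 1) χ with α ≤ ρ.re, (DirichletDisc.zeroOrder χ ρ : ℝ) ≤
            C_D * P ^ (c_D * (1 - α)))
    (hDHζ : ∀ P : ℝ, 2 ≤ P → ∀ (r : ℕ) [NeZero r] (χe : DirichletCharacter ℂ r) (β : ℝ),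
      IsExceptionalZero cH P r χe β → ∀ α : ℝ, 0 ≤ α → α ≤ 1 →
        ∑ ρ ∈ (weilZeroIndex_finite (P ^ 6)).toFinset with α ≤ ρ.re,
          ((riemannZetaZeroOrder ρ : ℤ) : ℝ) ≤ C_D * ((1 - β) * Real.log P) * P ^ (c_D * (1 - α)))
    (hDH : ∀ P : ℝ, 2 ≤ P → ∀ (r : ℕ) [NeZero r] (χe : DirichletCharacter ℂ r) (β : ℝ),
      IsExceptionalZero cH P r χe β → ∀ Z : (q : ℕ) → DirichletCharacter ℂ q → Finset ℂ,
      (∀ (q' : ℕ) (χ : DirichletCharacter ℂ (q' + 1)), ∀ ρ ∈ Z (q' + 1) χ,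
          χ.LFunction ρ = 0 ∧ 0 < ρ.re ∧ ρ.re < 1 ∧ |ρ.im| ≤ P ^ 6) →
      ∀ α : ℝ, 0 ≤ α → α ≤ 1 →
        ∑ q' ∈ Finset.Ico 1 ⌊P⌋₊, ∑ χ : DirichletCharacter ℂ (q' + 1) with χ.IsPrimitive,
          ∑ ρ ∈ Z (q' + 1) χ with (α ≤ ρ.re ∧
              ¬ (q' + 1 = r ∧ (∀ n : ℕ, χ (n : ZMod (q' + 1)) = χe (n : ZMod r)) ∧
                ρ = ((β : ℝ) : ℂ))),
            (DirichletDisc.zeroOrder χ ρ : ℝ) ≤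
            C_D * ((1 - β) * Real.log P) * P ^ (c_D * (1 - α))) :
    ∃ c : ℝ, 0 < c ∧ ∀ c₁ : ℝ, 0 < c₁ → c₁ ≤ c → lemma43At c₁ := by
  classical
  -- absolute constants
  obtain ⟨K, hK0, HK⟩ := exists_block_bound_char hEF
  obtain ⟨Cζ, hCζ0, HCζ⟩ := exists_block_bound_zeta hEFζ
  obtain ⟨c_b, hcb, Hbox⟩ := exists_boxZero_isExceptional
  obtain ⟨c_z, hcz, Hzeta⟩ := exists_zeta_no_boxZero
  obtain ⟨c_s, hcs, Hsimple⟩ := exists_isExceptionalZero_simple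
  obtain ⟨c_P, hcP, H41⟩ := lemma41At_of_lt
  obtain ⟨C_S, hCS, HSiegel⟩ := exists_one_sub_realZero_ge (ε := 1 / 8) (by norm_num)
  -- the level `c`
  set c : ℝ := min (min (min (c_b / 10) (c_z / 10)) (min (c_s / 2) (c_P / 2))) (min cH (1 / 2))
    with hcdef
  have hc0 : 0 < c := lt_min (lt_min (lt_min (by positivity) (by positivity))
    (lt_min (by positivity) (by positivity))) (lt_min hcH (by norm_num))
  have hc_b : 9 * c ≤ c_b := by
    have : c ≤ c_b / 10 := (min_le_left _ _).trans ((min_le_left _ _).trans (min_le_left _ _))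
    linarith
  have hc_b' : (10 / 9 * c) * (6 + 3) ≤ c_b := by
    have : c ≤ c_b / 10 := (min_le_left _ _).trans ((min_le_left _ _).trans (min_le_left _ _))
    linarith
  have hc_z : c * (6 + 3) ≤ c_z := by
    have : c ≤ c_z / 10 := (min_le_left _ _).trans ((min_le_left _ _).trans (min_le_right _ _))
    linarith
  have hc_s : c < c_s := by
    have : c ≤ c_s / 2 := (min_le_left _ _).trans ((min_le_right _ _).trans (min_le_left _ _))
    linarith
  have hc_P : c < c_P := by
    have : c ≤ c_P / 2 := (min_le_left _ _).trans ((min_le_right _ _).trans (min_le_right _ _))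
    linarith
  have hc_H : c ≤ cH := (min_le_right _ _).trans (min_le_left _ _)
  have hc2 : c ≤ 1 / 2 := (min_le_right _ _).trans (min_le_right _ _)
  have hc1 : c ≤ 1 := by linarith
  refine ⟨c, hc0, fun c₁ hc₁ hc₁c => lemma43At_anti hc₁ hc₁c ?_⟩
  -- `lemma43At c` with `c₃ = c`, `c₄ = min(1/20, 1/(6 + 2c_D))`
  set c₄ : ℝ := min (1 / 20) (1 / (6 + 2 * c_D)) with hc₄def
  have hc₄0 : 0 < c₄ := lt_min (by norm_num) (by positivity)
  have hc₄20 : c₄ ≤ 1 / 20 := min_le_left _ _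
  have hc₄D : c₄ ≤ 1 / (6 + 2 * c_D) := min_le_right _ _
  set M₀ : ℝ := 100 + 200 * K + 200 * Cζ with hM₀def
  have hM₀0 : 0 ≤ M₀ := by positivity
  set Cfin : ℝ := 3 + 10 * C_D * Real.exp (c * (5 + c_D)) + M₀ + 2 * (M₀ + 2) / C_S with hCfin
  have hCfin1 : 1 ≤ Cfin := by
    have : 0 ≤ 10 * C_D * Real.exp (c * (5 + c_D)) + M₀ + 2 * (M₀ + 2) / C_S := by positivity
    linarith
  have hCfin0 : 0 < Cfin := by linarith
  refine ⟨c, hc0, c₄, hc₄0, Cfin, fun N P hPexp hPN x h hx hh => ?_⟩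
  -- the weights and the trivial cases `N = 0`, `N = 1`
  have hP1' : 1 ≤ P := le_trans (Real.one_le_exp (Real.sqrt_nonneg _)) hPexp
  have hP0 : 0 < P := by linarith
  have hlogP0 : 0 ≤ Real.log P := Real.log_nonneg hP1'
  have hE0 : 0 < Real.exp (-c * Real.log N / Real.log P) := Real.exp_pos _
  rcases Nat.lt_or_ge N 2 with hN2 | hN2
  · -- `N ≤ 1`: every prime sum vanishes and the integer counts are `≤ 1`
    have hxh0 : ∀ (q : ℕ) (χ : DirichletCharacter ℂ q), x q χ ≤ 1 ∧ h q χ ≤ 1 :=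
      fun q χ => ⟨(hx q χ).trans (by omega), (hh q χ).trans (by omega)⟩
    -- for `N ≤ 1` the range forces `P = 1` when `N = 1`, and is arbitrary (`P ≥ 1`) when `N = 0`
    have hcps : ∀ (q : ℕ) (χ : DirichletCharacter ℂ q), charPrimeSum χ (x q χ) (h q χ) = 0 := by
      intro q χ
      rw [charPrimeSum]
      refine Finset.sum_eq_zero fun p hp => ?_
      exfalso
      rw [Finset.mem_filter, Finset.mem_Ioc] at hp
      have h2 := hp.2.two_le
      have h3 : p ≤ 1 := hp.1.2.trans (hxh0 q χ).1
      omega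
    rcases Nat.lt_or_ge N 1 with hN1 | hN1
    · -- `N = 0`: all `x = h = 0`, all terms vanish
      have hN0 : N = 0 := by omega
      subst hN0
      have hzero : ∀ (q : ℕ) (χ : DirichletCharacter ℂ q), x q χ = 0 ∧ h q χ = 0 :=
        fun q χ => ⟨Nat.le_zero.mp (hx q χ), Nat.le_zero.mp (hh q χ)⟩
      have hgT : ∀ (q : ℕ) (χ : DirichletCharacter ℂ q), gallagherTerm χ (x q χ) (h q χ) = 0 := by
        intro q χ
        rw [(hzero q χ).1, (hzero q χ).2]
        exact gallagherTerm_zero χ 0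
      have hgTE : ∀ (r : ℕ) (χe : DirichletCharacter ℂ r) (β : ℝ) (q : ℕ) (χ : DirichletCharacter ℂ q),
          gallagherTermExc χe β χ (x q χ) (h q χ) = 0 := by
        intro r χe β q χ
        rw [(hzero q χ).1, (hzero q χ).2]
        exact gallagherTermExc_zero χe β χ 0
      refine ⟨fun _ => ?_, fun r _ χe β hEZ => ?_⟩
      · rw [Finset.sum_eq_zero fun q _ => Finset.sum_eq_zero fun χ _ => by rw [hgT, norm_zero, mul_zero]]
        exact (mul_pos hCfin0 hE0).le
      · rw [Finset.sum_eq_zero fun q _ => Finset.sum_eq_zero fun χ _ => by rw [hgTE, norm_zero, mul_zero]]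
        obtain ⟨-, -, -, -, hβ1, -⟩ := hEZ
        have : 0 ≤ (1 - β) * Real.log P := mul_nonneg (by linarith) hlogP0
        exact mul_nonneg (mul_nonneg hCfin0.le this) hE0.le
    · -- `N = 1`: `P = 1`, one modulus, terms `≤ 1`
      have hN1' : N = 1 := by omega
      subst hN1'
      have hP1eq : P ≤ 1 := by simpa using hPN
      have hPeq : P = 1 := le_antisymm hP1eq hP1'
      have hfloor : ⌊P⌋₊ = 1 := by rw [hPeq]; simp
      have hw : ∀ (q : ℕ) (χ : DirichletCharacter ℂ q), ((h q χ : ℝ) + (1 : ℕ) / P)⁻¹ ≤ 1 := by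
        intro q χ
        apply inv_le_one_of_one_le₀
        have : (0 : ℝ) ≤ h q χ := Nat.cast_nonneg _
        rw [hPeq, Nat.cast_one, div_one]
        linarith
      have hgT : ∀ (q : ℕ) (χ : DirichletCharacter ℂ q), ‖gallagherTerm χ (x q χ) (h q χ)‖ ≤ 1 := by
        intro q χ
        rw [gallagherTerm, hcps, zero_sub, norm_neg]
        split_ifs
        · rw [Complex.norm_natCast]; exact_mod_cast (card_Ioc_sub_le _ _).trans (hx q χ)
        · simp
      have hlog1 : Real.log ((1 : ℕ) : ℝ) = 0 := by simp
      refine ⟨fun _ => ?_, fun r _ χe β hEZ => ?_⟩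
      · rw [hfloor, Finset.Icc_self, Finset.sum_singleton, hlog1]
        simp only [mul_zero, zero_div, Real.exp_zero, mul_one]
        calc ∑ χ : DirichletCharacter ℂ 1 with χ.IsPrimitive,
              ((h 1 χ : ℝ) + (1 : ℕ) / P)⁻¹ * ‖gallagherTerm χ (x 1 χ) (h 1 χ)‖
            ≤ (((univ : Finset (DirichletCharacter ℂ 1)).filter fun χ => χ.IsPrimitive).card : ℝ) * 1 := by
              rw [← nsmul_eq_mul]
              refine Finset.sum_le_card_nsmul _ _ _ fun χ _ => ?_
              calc ((h 1 χ : ℝ) + (1 : ℕ) / P)⁻¹ * ‖gallagherTerm χ (x 1 χ) (h 1 χ)‖ ≤ 1 * 1 :=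
                    mul_le_mul (hw 1 χ) (hgT 1 χ) (norm_nonneg _) zero_le_one
                _ = 1 := one_mul 1
          _ ≤ 1 * 1 := mul_le_mul_of_nonneg_right (card_filter_isPrimitive_le_self 1 |>.trans (by norm_num)) zero_le_one
          _ ≤ Cfin := by linarith
      · -- no exceptional datum at level `P = 1 ≥ r`: the character would be mod `1`, hence principal
        exfalso
        obtain ⟨_, hne, hrP, -, -, -⟩ := hEZ
        have hr1 : r ≤ 1 := by exact_mod_cast hrP.trans hP1eq
        have hr : r = 1 := le_antisymm hr1 (Nat.one_le_iff_ne_zero.mpr (NeZero.ne r))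
        subst hr
        exact hne (DirichletCharacter.level_one χe)
  -- Main case `N ≥ 2`.
  obtain ⟨-, h20, hP4, hPN', hP7, hP5, hlog2, hlog4⟩ := range_facts hN2 hc₄0 hc₄20 hPexp hPN
  have hP2 : 2 ≤ P := by linarith
  obtain ⟨-, hu₀2, hu₀N, hu₀lo, hu₀hi, hBu₀⟩ := scale_facts hN2 hP2 hcD hc₄D hPN
  -- the error budget (stated before the abbreviations `T`, `E`, `E_ζ`, which `set` then folds in)
  have hbudget := error_budget_le hN2 hP4 hPN' hP7 hP5 hlog2 hlog4 hK0 hCζ0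
  set u₀ : ℕ := ⌈(N : ℝ) / P ^ 5⌉₊ with hu₀def
  set T : ℝ := P ^ 6 with hTdef
  have hT6 : P ^ (6 : ℝ) = T := by rw [hTdef]; exact_mod_cast Real.rpow_natCast P 6
  have hT2 : 2 ≤ T := by
    rw [hTdef]
    calc (2 : ℝ) ≤ 2 ^ 6 := by norm_num
      _ ≤ P ^ 6 := pow_le_pow_left₀ (by norm_num) hP2 6
  have hT0 : 0 < T := by linarith
  have hN2r : (2 : ℝ) ≤ N := by exact_mod_cast hN2
  have hN0 : (0 : ℝ) < N := by linarith
  have hlogP : 0 < Real.log P := by linarith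
  have hlogN0 : 0 ≤ Real.log (N : ℝ) := Real.log_nonneg (by linarith)
  have hLN : Real.log N ≤ Real.log P ^ 2 := by
    -- `√log N ≤ log P`
    have hs : Real.sqrt (Real.log N) ≤ Real.log P := by
      have := Real.log_le_log (Real.exp_pos _) hPexp
      rwa [Real.log_exp] at this
    calc Real.log (N : ℝ) = Real.sqrt (Real.log N) ^ 2 := (Real.sq_sqrt hlogN0).symm
      _ ≤ Real.log P ^ 2 := pow_le_pow_left₀ (Real.sqrt_nonneg _) hs 2
  have hfloorP : 1 ≤ ⌊P⌋₊ := Nat.le_floor (by exact_mod_cast hP1')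
  have hfloorle : (⌊P⌋₊ : ℝ) ≤ P := Nat.floor_le hP0.le
  -- the parameters of the density lemma
  set B : ℝ := P ^ c_D with hBdef
  set η : ℝ := c / Real.log P with hηdef
  have hB1 : 1 ≤ B := Real.one_le_rpow hP1' hcD.le
  have hu₀1 : (1 : ℝ) < u₀ := by
    have : (2 : ℝ) ≤ u₀ := by exact_mod_cast hu₀2
    linarith
  have hη1 : η ≤ 1 := by
    rw [hηdef, div_le_one hlogP]; linarith
  have hη0 : 0 ≤ η := div_nonneg hc0.le hlogP.le
  have hsaving : (B / u₀) ^ η ≤ Real.exp (c * (5 + c_D)) * Real.exp (-c * Real.log N / Real.log P) :=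
    saving_le hN0 (by linarith) hc0.le hu₀lo
  -- the error budget
  set E : ℝ := 2 * Real.sqrt N * Real.log N + 2 * Real.log (N + 1) +
    K * (Real.log N + N / T * Real.log (P * N * T) ^ 2) with hEdef
  set Eζ : ℝ := 2 * Real.sqrt N * Real.log N + 2 * Real.log N + 1 +
    Cζ * (Real.log N + N / T * Real.log (N * T) ^ 2) with hEζdef
  have hlogN1 : 0 ≤ Real.log ((N : ℝ) + 1) := Real.log_nonneg (by linarith)
  have hlog40 : 0 ≤ Real.log 4 := Real.log_nonneg (by norm_num)
  have hEnn : 0 ≤ E := by rw [hEdef]; positivity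
  have hEζnn : 0 ≤ Eζ := by rw [hEζdef]; positivity
  have hu₀r0 : (0 : ℝ) ≤ u₀ := Nat.cast_nonneg _
  have hbudget' : 2 * P ^ 3 / N * ((Real.log 4 + 2) * u₀ + E + Eζ + 1) ≤ M₀ / P ^ 2 := by
    refine le_trans ?_ (hbudget.trans_eq (by rw [hM₀def]))
    apply mul_le_mul_of_nonneg_left _ (by positivity)
    have h3 : 0 ≤ Real.log 4 + 2 := by linarith
    linarith [mul_le_mul_of_nonneg_left hu₀hi h3]
  -- the uniform per-pair error and its sum over the pairs
  set err : ℝ := P / N * ((Real.log 4 + 2) * u₀ + E + Eζ + 1) with herrdef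
  have herr0 : 0 ≤ err := by rw [herrdef]; positivity
  have hpairs : err * (1 + ∑ q' ∈ Ico 1 ⌊P⌋₊, ((q' : ℝ) + 1)) ≤ M₀ / P ^ 2 := by
    have h1 : 1 + ∑ q' ∈ Ico 1 ⌊P⌋₊, ((q' : ℝ) + 1) ≤ 2 * P ^ 2 := by
      have := sum_Ico_succ_le_sq hfloorle
      have hP21 : (1 : ℝ) ≤ P ^ 2 := one_le_pow₀ hP1'
      linarith
    calc err * (1 + ∑ q' ∈ Ico 1 ⌊P⌋₊, ((q' : ℝ) + 1)) ≤ err * (2 * P ^ 2) :=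
          mul_le_mul_of_nonneg_left h1 herr0
      _ = 2 * P ^ 3 / N * ((Real.log 4 + 2) * u₀ + E + Eζ + 1) := by
          rw [herrdef]; ring
      _ ≤ M₀ / P ^ 2 := hbudget'
  -- the finite sets of zeros
  set Zfin : (q : ℕ) → DirichletCharacter ℂ q → Finset ℂ := fun q χ =>
    if hq : q = 0 then ∅ else
      haveI : NeZero q := ⟨hq⟩
      if hχ : χ = 1 then ∅ else (lfunctionZeroBox_finite hχ T).toFinset with hZfin
  have hZfin_eq : ∀ (q' : ℕ) (χ : DirichletCharacter ℂ (q' + 1)) (hχ : χ ≠ 1),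
      Zfin (q' + 1) χ = (lfunctionZeroBox_finite hχ T).toFinset := by
    intro q' χ hχ
    simp only [hZfin]
    rw [dif_neg (Nat.succ_ne_zero q'), dif_neg hχ]
  have hZfin_mem : ∀ (q' : ℕ) (χ : DirichletCharacter ℂ (q' + 1)), ∀ ρ ∈ Zfin (q' + 1) χ,
      χ.LFunction ρ = 0 ∧ 0 < ρ.re ∧ ρ.re < 1 ∧ |ρ.im| ≤ P ^ 6 := by
    intro q' χ ρ hρ
    by_cases hχ : χ = 1
    · subst hχ; simp [hZfin] at hρ
    · rw [hZfin_eq q' χ hχ] at hρ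
      exact mem_toFinset_lfunctionZeroBox hχ hρ
  -- primitive characters mod `q' + 1 ≥ 2` are non-principal
  have hne1 : ∀ (q' : ℕ), 1 ≤ q' → ∀ (χ : DirichletCharacter ℂ (q' + 1)), χ.IsPrimitive → χ ≠ 1 := by
    intro q' hq' χ hprim hχ
    subst hχ
    have := eq_one_of_isPrimitive_one hprim
    omega
  -- reindex the sum over `q`
  have hsplit : ∀ F : ℕ → ℝ, ∑ q ∈ Icc 1 ⌊P⌋₊, F q = F 1 + ∑ q' ∈ Ico 1 ⌊P⌋₊, F (q' + 1) :=
    fun F => sum_Icc_one_eq F hfloorP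
  -- the `q = 1` term: one character, `ζ`
  have hcard1 : (((univ : Finset (DirichletCharacter ℂ 1)).filter fun χ => χ.IsPrimitive).card : ℝ) ≤ 1 := by
    have := card_filter_isPrimitive_le_self 1
    exact this.trans_eq (by norm_num)
  -- the zeros of `ζ` in the box
  set Sζ := (weilZeroIndex_finite T).toFinset with hSζ
  have hζre : ∀ ρ ∈ Sζ, ρ.re ≤ 1 - η := by
    intro ρ hρ
    obtain ⟨h0, -, -, -, h4, -⟩ := mem_toFinset_weilZeroIndex hρ
    have := Hzeta 6 (by norm_num) c P hc0 hc_z hP2 ρ h0 (by rw [hT6]; exact h4)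
    rwa [hηdef]
  have hζpos : ∀ ρ ∈ Sζ, 0 ≤ ρ.re := fun ρ hρ => (mem_toFinset_weilZeroIndex hρ).2.1
  have hζw : ∀ ρ ∈ Sζ, 0 ≤ ((riemannZetaZeroOrder ρ : ℤ) : ℝ) := fun ρ hρ =>
    (mem_toFinset_weilZeroIndex hρ).2.2.2.2.2.2.2
  set Uζ : ℝ := ∑ ρ ∈ Sζ, ((riemannZetaZeroOrder ρ : ℤ) : ℝ) * (u₀ : ℝ) ^ (ρ.re - 1) with hUζdef
  -- the bound of the `q = 1` term by `Uζ + err`, uniformly (also in the exceptional clause, where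
  -- the correction does not apply to the character mod `1`)
  have hterm1 : ∀ χ : DirichletCharacter ℂ 1,
      ((h 1 χ : ℝ) + N / P)⁻¹ * ‖gallagherTerm χ (x 1 χ) (h 1 χ)‖ ≤ Uζ + err := by
    intro χ
    have := weighted_gallagherTerm_modOne_le hCζ0 HCζ hP2 hT2 χ hu₀2 hu₀N (hx 1 χ) (h := h 1 χ)
    refine this.trans (add_le_add le_rfl ?_)
    rw [herrdef]
    apply mul_le_mul_of_nonneg_left _ (by positivity)
    rw [hEζdef]
    linarith
  have hsum1 : ∑ χ : DirichletCharacter ℂ 1 with χ.IsPrimitive,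
      ((h 1 χ : ℝ) + N / P)⁻¹ * ‖gallagherTerm χ (x 1 χ) (h 1 χ)‖ ≤ Uζ + err := by
    have hUζ0 : 0 ≤ Uζ := Finset.sum_nonneg fun ρ hρ => by
      have := hζw ρ hρ; positivity
    calc _ ≤ (((univ : Finset (DirichletCharacter ℂ 1)).filter fun χ => χ.IsPrimitive).card : ℝ) * (Uζ + err) := by
          rw [← nsmul_eq_mul]
          exact Finset.sum_le_card_nsmul _ _ _ fun χ _ => hterm1 χ
      _ ≤ 1 * (Uζ + err) := mul_le_mul_of_nonneg_right hcard1 (by positivity)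
      _ = Uζ + err := one_mul _
  ------------------------------------------------------------------
  refine ⟨fun hnone => ?_, fun r _ χe β hEZ => ?_⟩
  · ----------------------------------------------------------------
    -- (a) no exceptional datum at level `c`
    -- every zero of a primitive `χ` mod `q' + 1 ≥ 2` in the box has `Re ρ ≤ 1 − η`
    have hre : ∀ q' ∈ Ico 1 ⌊P⌋₊, ∀ χ ∈ (univ : Finset (DirichletCharacter ℂ (q' + 1))).filter
        (fun χ => χ.IsPrimitive), ∀ ρ ∈ Zfin (q' + 1) χ, ρ.re ≤ 1 - η := by
      intro q' hq' χ hχ ρ hρ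
      rw [Finset.mem_Ico] at hq'
      rw [Finset.mem_filter] at hχ
      have hχ1 := hne1 q' hq'.1 χ hχ.2
      obtain ⟨hL, -, -, him⟩ := hZfin_mem q' χ ρ hρ
      have hqP : ((q' + 1 : ℕ) : ℝ) ≤ P := by
        have : ((q' + 1 : ℕ) : ℝ) ≤ ⌊P⌋₊ := by exact_mod_cast hq'.2
        exact this.trans hfloorle
      have := boxZero_re_le_of_none Hbox hc0 hc_b hP2 hnone hχ.2 hχ1 hqP hL (by rw [hT6]; exact him)
      rwa [hηdef]
    -- the zero sums
    have hUsum : ∑ q' ∈ Ico 1 ⌊P⌋₊, ∑ χ : DirichletCharacter ℂ (q' + 1) with χ.IsPrimitive,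
        ∑ ρ ∈ Zfin (q' + 1) χ, (DirichletDisc.zeroOrder χ ρ : ℝ) * (u₀ : ℝ) ^ (ρ.re - 1) ≤
          5 * C_D * (B / u₀) ^ η := by
      refine sum_sum_sum_mul_rpow_le_of_density₀ (Ico 1 ⌊P⌋₊)
        (fun q' => (univ : Finset (DirichletCharacter ℂ (q' + 1))).filter fun χ => χ.IsPrimitive)
        (fun q' χ => Zfin (q' + 1) χ) (fun q' χ ρ => (DirichletDisc.zeroOrder χ ρ : ℝ))
        hu₀1 hB1 hBu₀ hCD.le hη1 (fun _ _ _ _ _ _ => Nat.cast_nonneg _)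
        (fun q' _ χ _ ρ hρ => (hZfin_mem q' χ ρ hρ).2.1.le) hre ?_
      intro α' hα'0 hα'1
      have h := hZD P hP2 Zfin hZfin_mem α' hα'0 (by linarith)
      rw [hBdef, ← Real.rpow_mul hP0.le]
      exact h
    have hUζ : Uζ ≤ 5 * C_D * (B / u₀) ^ η := by
      refine sum_mul_rpow_sub_one_le_of_density₀ Sζ (fun ρ => ρ.re)
        (fun ρ => ((riemannZetaZeroOrder ρ : ℤ) : ℝ)) hu₀1 hB1 hBu₀ hCD.le hη1 hζw hζpos hζre ?_
      intro α' hα'0 hα'1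
      have h := hZDζ P hP2 α' hα'0 (by linarith)
      rw [hBdef, ← Real.rpow_mul hP0.le]
      exact h
    -- the terms with `q' + 1 ≥ 2`
    have hterm : ∀ q' ∈ Ico 1 ⌊P⌋₊, ∀ χ ∈ (univ : Finset (DirichletCharacter ℂ (q' + 1))).filter
        (fun χ => χ.IsPrimitive),
        ((h (q' + 1) χ : ℝ) + N / P)⁻¹ * ‖gallagherTerm χ (x (q' + 1) χ) (h (q' + 1) χ)‖ ≤
          (∑ ρ ∈ Zfin (q' + 1) χ, (DirichletDisc.zeroOrder χ ρ : ℝ) * (u₀ : ℝ) ^ (ρ.re - 1)) + err := by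
      intro q' hq' χ hχ
      rw [Finset.mem_Ico] at hq'
      rw [Finset.mem_filter] at hχ
      have hχ1 := hne1 q' hq'.1 χ hχ.2
      have hqP : ((q' + 1 : ℕ) : ℝ) ≤ P := by
        have : ((q' + 1 : ℕ) : ℝ) ≤ ⌊P⌋₊ := by exact_mod_cast hq'.2
        exact this.trans hfloorle
      have hq2 : 1 < q' + 1 := by omega
      have := weighted_gallagherTerm_le hK0 HK hP2 hT2 hq2 hqP hχ.2 hχ1 hu₀2 hu₀N (hx (q' + 1) χ)
        (h := h (q' + 1) χ)
      rw [hZfin_eq q' χ hχ1]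
      refine this.trans (add_le_add le_rfl ?_)
      rw [herrdef]
      apply mul_le_mul_of_nonneg_left _ (by positivity)
      rw [hEdef]
      linarith
    have hsum2 : ∑ q' ∈ Ico 1 ⌊P⌋₊, ∑ χ : DirichletCharacter ℂ (q' + 1) with χ.IsPrimitive,
        ((h (q' + 1) χ : ℝ) + N / P)⁻¹ * ‖gallagherTerm χ (x (q' + 1) χ) (h (q' + 1) χ)‖ ≤
        5 * C_D * (B / u₀) ^ η + err * ∑ q' ∈ Ico 1 ⌊P⌋₊, ((q' : ℝ) + 1) := by
      calc _ ≤ ∑ q' ∈ Ico 1 ⌊P⌋₊, ∑ χ : DirichletCharacter ℂ (q' + 1) with χ.IsPrimitive,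
            ((∑ ρ ∈ Zfin (q' + 1) χ, (DirichletDisc.zeroOrder χ ρ : ℝ) * (u₀ : ℝ) ^ (ρ.re - 1)) + err) :=
            Finset.sum_le_sum fun q' hq' => Finset.sum_le_sum fun χ hχ => hterm q' hq' χ hχ
        _ = (∑ q' ∈ Ico 1 ⌊P⌋₊, ∑ χ : DirichletCharacter ℂ (q' + 1) with χ.IsPrimitive,
              ∑ ρ ∈ Zfin (q' + 1) χ, (DirichletDisc.zeroOrder χ ρ : ℝ) * (u₀ : ℝ) ^ (ρ.re - 1)) +
            ∑ q' ∈ Ico 1 ⌊P⌋₊, ∑ χ : DirichletCharacter ℂ (q' + 1) with χ.IsPrimitive, err := by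
            rw [← Finset.sum_add_distrib]
            refine Finset.sum_congr rfl fun q' _ => ?_
            rw [Finset.sum_add_distrib]
        _ ≤ 5 * C_D * (B / u₀) ^ η + err * ∑ q' ∈ Ico 1 ⌊P⌋₊, ((q' : ℝ) + 1) := by
            refine add_le_add hUsum ?_
            rw [Finset.mul_sum]
            refine Finset.sum_le_sum fun q' _ => ?_
            rw [Finset.sum_const, nsmul_eq_mul]
            have := card_filter_isPrimitive_le_self (q' + 1)
            push_cast at this
            calc _ ≤ ((q' : ℝ) + 1) * err := mul_le_mul_of_nonneg_right this herr0
              _ = err * ((q' : ℝ) + 1) := mul_comm _ _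
    -- assemble (a)
    rw [hsplit (fun q => ∑ χ : DirichletCharacter ℂ q with χ.IsPrimitive,
      ((h q χ : ℝ) + N / P)⁻¹ * ‖gallagherTerm χ (x q χ) (h q χ)‖)]
    have hinvsq : (P ^ 2)⁻¹ ≤ Real.exp (-c * Real.log N / Real.log P) :=
      inv_sq_le_exp_neg hP1' hc1 hlogN0 hLN
    calc _ ≤ (Uζ + err) + (5 * C_D * (B / u₀) ^ η + err * ∑ q' ∈ Ico 1 ⌊P⌋₊, ((q' : ℝ) + 1)) :=
          add_le_add hsum1 hsum2
      _ = (Uζ + 5 * C_D * (B / u₀) ^ η) + err * (1 + ∑ q' ∈ Ico 1 ⌊P⌋₊, ((q' : ℝ) + 1)) := by ring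
      _ ≤ 10 * C_D * (B / u₀) ^ η + M₀ / P ^ 2 := by linarith [hUζ, hpairs]
      _ ≤ 10 * C_D * (Real.exp (c * (5 + c_D)) * Real.exp (-c * Real.log N / Real.log P)) +
            M₀ * Real.exp (-c * Real.log N / Real.log P) := by
          refine add_le_add (mul_le_mul_of_nonneg_left hsaving (by positivity)) ?_
          rw [div_eq_mul_inv]
          exact mul_le_mul_of_nonneg_left hinvsq hM₀0
      _ ≤ Cfin * Real.exp (-c * Real.log N / Real.log P) := by
          rw [hCfin]
          have : 0 ≤ (3 + 2 * (M₀ + 2) / C_S) * Real.exp (-c * Real.log N / Real.log P) := by positivity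
          linarith [this]
  · ----------------------------------------------------------------
    -- (b) the exceptional datum `(r, χe, β)` at level `c`
    have hEZ' := hEZ
    obtain ⟨hprim_e, hne_e, hrP, hβlo, hβ1, hzero⟩ := hEZ'
    -- `r ≥ 2`
    have hr2 : 1 < r := by
      rcases Nat.lt_or_ge 1 r with h1 | h1
      · exact h1
      · exfalso
        have hr1 : r = 1 := le_antisymm h1 (Nat.one_le_iff_ne_zero.mpr (NeZero.ne r))
        subst hr1
        exact hne_e (DirichletCharacter.level_one χe)
    have hr1r : (1 : ℝ) ≤ r := by exact_mod_cast hr2.le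
    -- `β > 0`, quadratic (box lemma), Siegel's bound, uniqueness at level `c`
    have hβ0 : 0 < β := by
      have : c / Real.log P < 1 := by rw [div_lt_one hlogP]; linarith
      linarith
    have hquad : χe ^ 2 = 1 := by
      have hstrict : 1 - (10 / 9 * c) / Real.log P < ((β : ℝ) : ℂ).re := by
        simp only [Complex.ofReal_re]
        have : c / Real.log P < (10 / 9 * c) / Real.log P := by
          apply div_lt_div_of_pos_right _ hlogP; linarith
        linarith
      exact (Hbox 6 (by norm_num) (10 / 9 * c) P (by positivity) hc_b' hP2 r χe hprim_e hne_e hrP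
        ((β : ℝ) : ℂ) hzero (by rw [Complex.ofReal_im, abs_zero]; positivity) hstrict).2.1
    have hSieg : C_S * (r : ℝ) ^ (-(1 / 8 : ℝ)) ≤ 1 - β := HSiegel r χe hquad hne_e β hzero
    have h41 : Lemma41At c P := H41 c P hc0 hc_P hP4
    have hEZ_H : IsExceptionalZero cH P r χe β := hEZ.mono hc_H hP1'
    have hL0 : 0 ≤ (1 - β) * Real.log P := mul_nonneg (by linarith) hlogP.le
    -- the exceptional predicate and the reduced sets of zeros
    set Zexc : (q : ℕ) → DirichletCharacter ℂ q → Finset ℂ := fun q χ =>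
      (Zfin q χ).filter fun ρ => ¬ (q = r ∧ (∀ n : ℕ, χ (n : ZMod q) = χe (n : ZMod r)) ∧
        ρ = ((β : ℝ) : ℂ)) with hZexc
    have hZexc_sub : ∀ (q : ℕ) (χ : DirichletCharacter ℂ q), Zexc q χ ⊆ Zfin q χ :=
      fun q χ => Finset.filter_subset _ _
    -- every zero in `Zexc` has `Re ρ ≤ 1 − η`
    have hre : ∀ q' ∈ Ico 1 ⌊P⌋₊, ∀ χ ∈ (univ : Finset (DirichletCharacter ℂ (q' + 1))).filter
        (fun χ => χ.IsPrimitive), ∀ ρ ∈ Zexc (q' + 1) χ, ρ.re ≤ 1 - η := by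
      intro q' hq' χ hχ ρ hρ
      rw [Finset.mem_Ico] at hq'
      rw [Finset.mem_filter] at hχ
      have hχ1 := hne1 q' hq'.1 χ hχ.2
      simp only [hZexc, Finset.mem_filter] at hρ
      obtain ⟨hρZ, hne⟩ := hρ
      obtain ⟨hL, -, -, him⟩ := hZfin_mem q' χ ρ hρZ
      have hqP : ((q' + 1 : ℕ) : ℝ) ≤ P := by
        have : ((q' + 1 : ℕ) : ℝ) ≤ ⌊P⌋₊ := by exact_mod_cast hq'.2
        exact this.trans hfloorle
      have := boxZero_re_le_of_exceptional Hbox hc0 hc_b hP2 h41 hEZ hχ.2 hχ1 hqP hL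
        (by rw [hT6]; exact him) hne
      rwa [hηdef]
    -- the zero sums with the Deuring–Heilbronn factor
    have hUsum : ∑ q' ∈ Ico 1 ⌊P⌋₊, ∑ χ : DirichletCharacter ℂ (q' + 1) with χ.IsPrimitive,
        ∑ ρ ∈ Zexc (q' + 1) χ, (DirichletDisc.zeroOrder χ ρ : ℝ) * (u₀ : ℝ) ^ (ρ.re - 1) ≤
          5 * (C_D * ((1 - β) * Real.log P)) * (B / u₀) ^ η := by
      refine sum_sum_sum_mul_rpow_le_of_density₀ (Ico 1 ⌊P⌋₊)
        (fun q' => (univ : Finset (DirichletCharacter ℂ (q' + 1))).filter fun χ => χ.IsPrimitive)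
        (fun q' χ => Zexc (q' + 1) χ) (fun q' χ ρ => (DirichletDisc.zeroOrder χ ρ : ℝ))
        hu₀1 hB1 hBu₀ (by positivity) hη1 (fun _ _ _ _ _ _ => Nat.cast_nonneg _)
        (fun q' _ χ _ ρ hρ => (hZfin_mem q' χ ρ (hZexc_sub _ _ hρ)).2.1.le) hre ?_
      intro α' hα'0 hα'1
      have h := hDH P hP2 r χe β hEZ_H Zfin hZfin_mem α' hα'0 (by linarith)
      rw [hBdef, ← Real.rpow_mul hP0.le]
      refine le_trans (le_of_eq ?_) h
      refine Finset.sum_congr rfl fun q' _ => Finset.sum_congr rfl fun χ _ => ?_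
      simp only [hZexc, Finset.filter_filter]
      refine Finset.sum_congr ?_ fun _ _ => rfl
      ext ρ
      simp only [Finset.mem_filter]
      tauto
    have hUζ : Uζ ≤ 5 * (C_D * ((1 - β) * Real.log P)) * (B / u₀) ^ η := by
      refine sum_mul_rpow_sub_one_le_of_density₀ Sζ (fun ρ => ρ.re)
        (fun ρ => ((riemannZetaZeroOrder ρ : ℤ) : ℝ)) hu₀1 hB1 hBu₀ (by positivity) hη1 hζw hζpos
        hζre ?_
      intro α' hα'0 hα'1
      have h := hDHζ P hP2 r χe β hEZ_H α' hα'0 (by linarith)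
      rw [hBdef, ← Real.rpow_mul hP0.le]
      exact h
    -- the terms with `q' + 1 ≥ 2`
    have hterm : ∀ q' ∈ Ico 1 ⌊P⌋₊, ∀ χ ∈ (univ : Finset (DirichletCharacter ℂ (q' + 1))).filter
        (fun χ => χ.IsPrimitive),
        ((h (q' + 1) χ : ℝ) + N / P)⁻¹ * ‖gallagherTermExc χe β χ (x (q' + 1) χ) (h (q' + 1) χ)‖ ≤
          (∑ ρ ∈ Zexc (q' + 1) χ, (DirichletDisc.zeroOrder χ ρ : ℝ) * (u₀ : ℝ) ^ (ρ.re - 1)) +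
            (err + P / N) := by
      intro q' hq' χ hχ
      rw [Finset.mem_Ico] at hq'
      rw [Finset.mem_filter] at hχ
      have hχ1 := hne1 q' hq'.1 χ hχ.2
      have hqP : ((q' + 1 : ℕ) : ℝ) ≤ P := by
        have : ((q' + 1 : ℕ) : ℝ) ≤ ⌊P⌋₊ := by exact_mod_cast hq'.2
        exact this.trans hfloorle
      have hq2 : 1 < q' + 1 := by omega
      have hPN0 : 0 ≤ P / N := by positivity
      by_cases hid : q' + 1 = r ∧ ∀ n : ℕ, χ (n : ZMod (q' + 1)) = χe (n : ZMod r)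
      · -- the exceptional character itself (same modulus, same values): transport the datum
        obtain ⟨hqr, hχχ⟩ := hid
        have hEZχ : IsExceptionalZero c P (q' + 1) χ β := hEZ.transport hqr hχχ
        have hmemχ : ((β : ℝ) : ℂ) ∈ (lfunctionZeroBox_finite hχ1 T).toFinset := by
          rw [Set.Finite.mem_toFinset, mem_lfunctionZeroBox]
          exact ofReal_mem_box_of_isExceptionalZero hc0 hc2 hP2 hEZχ (by linarith)
        obtain ⟨-, hsimpleχ⟩ := Hsimple c P hc0 hc_s hP2 (q' + 1) χ β hEZχ
        have hself : gallagherTermExc χe β χ (x (q' + 1) χ) (h (q' + 1) χ) =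
            gallagherTermExc χ β χ (x (q' + 1) χ) (h (q' + 1) χ) := by
          rw [gallagherTermExc, gallagherTermExc, if_pos ⟨hqr, hχχ⟩, if_pos ⟨rfl, fun n => rfl⟩]
        have := weighted_gallagherTermExc_self_le hK0 HK hP2 hT2 hq2 hqP hχ.2 hχ1 hβ0 hβ1.le
          hmemχ hsimpleχ hu₀2 hu₀N (hx (q' + 1) χ) (h := h (q' + 1) χ)
        -- `Zexc = box.erase β`
        have hZexc_eq : Zexc (q' + 1) χ = ((lfunctionZeroBox_finite hχ1 T).toFinset).erase ((β : ℝ) : ℂ) := by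
          simp only [hZexc]
          rw [hZfin_eq q' χ hχ1, ← Finset.filter_ne']
          refine Finset.filter_congr fun ρ _ => ?_
          constructor
          · intro hne heq; exact hne ⟨hqr, hχχ, heq⟩
          · rintro hne ⟨-, -, heq⟩; exact hne heq
        rw [hself, hZexc_eq]
        refine this.trans (add_le_add le_rfl ?_)
        rw [herrdef]
        have hE_le : (Real.log 4 + 2) * (u₀ : ℝ) + E + 1 ≤ ((Real.log 4 + 2) * u₀ + E + Eζ + 1) + 1 := by
          linarith
        calc P / N * ((Real.log 4 + 2) * u₀ + (2 * Real.sqrt N * Real.log N + 2 * Real.log (N + 1) +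
              K * (Real.log N + N / T * Real.log (P * N * T) ^ 2)) + 1)
            = P / N * ((Real.log 4 + 2) * u₀ + E + 1) := by rw [hEdef]
          _ ≤ P / N * (((Real.log 4 + 2) * u₀ + E + Eζ + 1) + 1) :=
              mul_le_mul_of_nonneg_left hE_le hPN0
          _ = P / N * ((Real.log 4 + 2) * u₀ + E + Eζ + 1) + P / N := by ring
      · -- any other character: no correction, all its zeros in `Zexc = Zfin`
        have hgTE : gallagherTermExc χe β χ (x (q' + 1) χ) (h (q' + 1) χ) =
            gallagherTerm χ (x (q' + 1) χ) (h (q' + 1) χ) := by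
          rw [gallagherTermExc, if_neg hid, add_zero]
        have hZexc_eq : Zexc (q' + 1) χ = Zfin (q' + 1) χ := by
          simp only [hZexc]
          refine Finset.filter_true_of_mem fun ρ _ => ?_
          rintro ⟨h1, h2, -⟩
          exact hid ⟨h1, h2⟩
        rw [hgTE, hZexc_eq, hZfin_eq q' χ hχ1]
        have := weighted_gallagherTerm_le hK0 HK hP2 hT2 hq2 hqP hχ.2 hχ1 hu₀2 hu₀N (hx (q' + 1) χ)
          (h := h (q' + 1) χ)
        refine this.trans (add_le_add le_rfl ?_)
        rw [herrdef]
        have hE_le : (Real.log 4 + 2) * (u₀ : ℝ) + E ≤ (Real.log 4 + 2) * u₀ + E + Eζ + 1 := by linarith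
        calc P / N * ((Real.log 4 + 2) * u₀ + (2 * Real.sqrt N * Real.log N + 2 * Real.log (N + 1) +
              K * (Real.log N + N / T * Real.log (P * N * T) ^ 2)))
            = P / N * ((Real.log 4 + 2) * u₀ + E) := by rw [hEdef]
          _ ≤ P / N * ((Real.log 4 + 2) * u₀ + E + Eζ + 1) := mul_le_mul_of_nonneg_left hE_le hPN0
          _ ≤ P / N * ((Real.log 4 + 2) * u₀ + E + Eζ + 1) + P / N := by linarith
    have hsum2 : ∑ q' ∈ Ico 1 ⌊P⌋₊, ∑ χ : DirichletCharacter ℂ (q' + 1) with χ.IsPrimitive,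
        ((h (q' + 1) χ : ℝ) + N / P)⁻¹ * ‖gallagherTermExc χe β χ (x (q' + 1) χ) (h (q' + 1) χ)‖ ≤
        5 * (C_D * ((1 - β) * Real.log P)) * (B / u₀) ^ η +
          (err + P / N) * ∑ q' ∈ Ico 1 ⌊P⌋₊, ((q' : ℝ) + 1) := by
      have herr1 : 0 ≤ err + P / N := by positivity
      calc _ ≤ ∑ q' ∈ Ico 1 ⌊P⌋₊, ∑ χ : DirichletCharacter ℂ (q' + 1) with χ.IsPrimitive,
            ((∑ ρ ∈ Zexc (q' + 1) χ, (DirichletDisc.zeroOrder χ ρ : ℝ) * (u₀ : ℝ) ^ (ρ.re - 1)) +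
              (err + P / N)) :=
            Finset.sum_le_sum fun q' hq' => Finset.sum_le_sum fun χ hχ => hterm q' hq' χ hχ
        _ = (∑ q' ∈ Ico 1 ⌊P⌋₊, ∑ χ : DirichletCharacter ℂ (q' + 1) with χ.IsPrimitive,
              ∑ ρ ∈ Zexc (q' + 1) χ, (DirichletDisc.zeroOrder χ ρ : ℝ) * (u₀ : ℝ) ^ (ρ.re - 1)) +
            ∑ q' ∈ Ico 1 ⌊P⌋₊, ∑ χ : DirichletCharacter ℂ (q' + 1) with χ.IsPrimitive, (err + P / N) := by
            rw [← Finset.sum_add_distrib]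
            refine Finset.sum_congr rfl fun q' _ => ?_
            rw [Finset.sum_add_distrib]
        _ ≤ _ := by
            refine add_le_add hUsum ?_
            rw [Finset.mul_sum]
            refine Finset.sum_le_sum fun q' _ => ?_
            rw [Finset.sum_const, nsmul_eq_mul]
            have := card_filter_isPrimitive_le_self (q' + 1)
            push_cast at this
            calc _ ≤ ((q' : ℝ) + 1) * (err + P / N) := mul_le_mul_of_nonneg_right this herr1
              _ = (err + P / N) * ((q' : ℝ) + 1) := mul_comm _ _
    -- the `q = 1` term in the exceptional clause: no correction for the character mod `1`
    have hsum1' : ∑ χ : DirichletCharacter ℂ 1 with χ.IsPrimitive,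
        ((h 1 χ : ℝ) + N / P)⁻¹ * ‖gallagherTermExc χe β χ (x 1 χ) (h 1 χ)‖ ≤ Uζ + err := by
      refine le_trans (le_of_eq ?_) hsum1
      refine Finset.sum_congr rfl fun χ _ => ?_
      have hid : ¬ (1 = r ∧ ∀ n : ℕ, χ (n : ZMod 1) = χe (n : ZMod r)) := fun hh => absurd hh.1 (by omega)
      rw [gallagherTermExc, if_neg hid, add_zero]
    -- the extra `P/N` per pair: `(P/N) P² ≤ P³/N ≤ 1/P²`... absorbed: `(P/N)(1 + ΣΣ) ≤ 2P³/N ≤ 2/P²`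
    have hextra : P / N * ∑ q' ∈ Ico 1 ⌊P⌋₊, ((q' : ℝ) + 1) ≤ 2 / P ^ 2 := by
      have h1 := sum_Ico_succ_le_sq hfloorle
      have hP5N : P ^ 5 ≤ N := le_trans (pow_le_pow_right₀ hP1' (by norm_num)) hP7
      calc P / N * ∑ q' ∈ Ico 1 ⌊P⌋₊, ((q' : ℝ) + 1) ≤ P / N * P ^ 2 :=
            mul_le_mul_of_nonneg_left h1 (by positivity)
        _ = P ^ 3 / N := by ring
        _ ≤ 2 / P ^ 2 := by
            rw [div_le_div_iff₀ hN0 (by positivity)]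
            have : P ^ 3 * P ^ 2 = P ^ 5 := by ring
            linarith [this]
    -- assemble (b)
    rw [hsplit (fun q => ∑ χ : DirichletCharacter ℂ q with χ.IsPrimitive,
      ((h q χ : ℝ) + N / P)⁻¹ * ‖gallagherTermExc χe β χ (x q χ) (h q χ)‖)]
    have hfac : (M₀ + 2) / P ^ 2 ≤ 2 * (M₀ + 2) / C_S * ((1 - β) * Real.log P) *
        Real.exp (-c * Real.log N / Real.log P) :=
      div_sq_le_exc_factor (by positivity) hCS hP2 hr1r hrP hSieg hc1 hlogN0 hLN
    set X : ℝ := Real.exp (-c * Real.log N / Real.log P) with hXdef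
    set Lβ : ℝ := (1 - β) * Real.log P with hLβ
    calc _ ≤ (Uζ + err) + (5 * (C_D * Lβ) * (B / u₀) ^ η + (err + P / N) * ∑ q' ∈ Ico 1 ⌊P⌋₊, ((q' : ℝ) + 1)) :=
          add_le_add hsum1' hsum2
      _ = (Uζ + 5 * (C_D * Lβ) * (B / u₀) ^ η) + err * (1 + ∑ q' ∈ Ico 1 ⌊P⌋₊, ((q' : ℝ) + 1)) +
            P / N * ∑ q' ∈ Ico 1 ⌊P⌋₊, ((q' : ℝ) + 1) := by ring
      _ ≤ 10 * (C_D * Lβ) * (B / u₀) ^ η + M₀ / P ^ 2 + 2 / P ^ 2 := by linarith [hUζ, hpairs, hextra]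
      _ = 10 * (C_D * Lβ) * (B / u₀) ^ η + (M₀ + 2) / P ^ 2 := by ring
      _ ≤ 10 * (C_D * Lβ) * (Real.exp (c * (5 + c_D)) * X) + 2 * (M₀ + 2) / C_S * Lβ * X := by
          refine add_le_add (mul_le_mul_of_nonneg_left hsaving (by positivity)) hfac
      _ ≤ Cfin * Lβ * X := by
          rw [hCfin]
          have hX0 : 0 ≤ X := (Real.exp_pos _).le
          have h1 : 0 ≤ (3 + M₀) * (Lβ * X) := mul_nonneg (by positivity) (mul_nonneg hL0 hX0)
          linarith [h1]

/-! ### Corollaries: `lemma43_gallagher`, (8.3) and Theorem 1 from the same inputs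

(The hypotheses are repeated as explicit binders: these are CONDITIONAL theorems; nothing here
discharges the named facts `lemma43_gallagher`, `majorArc_lowerBound`,
`Literature.NumberTheory.Sieve.goldbachExceptionalCount_isBigO_rpow`.) -/

open scoped Classical in
/-- **The named fact `lemma43_gallagher` (M–V Lemma 4.3) FOLLOWS from the explicit formulae and
the log-free density hypotheses** (conditional theorem).
[cite: MontgomeryVaughanActa1975, §4 Lemma 4.3 (4.2)] -/
theorem lemma43_gallagher_of_explicitFormula_of_density
    (hEF : truncatedExplicitFormula_psiChar) (hEFζ : truncatedExplicitFormula_psi)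
    {c_D C_D cH : ℝ} (hcD : 0 < c_D) (hCD : 0 < C_D) (hcH : 0 < cH)
    (hZDζ : ∀ P : ℝ, 2 ≤ P → ∀ α : ℝ, 0 ≤ α → α ≤ 1 →
      ∑ ρ ∈ (weilZeroIndex_finite (P ^ 6)).toFinset with α ≤ ρ.re,
        ((riemannZetaZeroOrder ρ : ℤ) : ℝ) ≤ C_D * P ^ (c_D * (1 - α)))
    (hZD : ∀ P : ℝ, 2 ≤ P → ∀ Z : (q : ℕ) → DirichletCharacter ℂ q → Finset ℂ,
      (∀ (q' : ℕ) (χ : DirichletCharacter ℂ (q' + 1)), ∀ ρ ∈ Z (q' + 1) χ,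
          χ.LFunction ρ = 0 ∧ 0 < ρ.re ∧ ρ.re < 1 ∧ |ρ.im| ≤ P ^ 6) →
      ∀ α : ℝ, 0 ≤ α → α ≤ 1 →
        ∑ q' ∈ Finset.Ico 1 ⌊P⌋₊, ∑ χ : DirichletCharacter ℂ (q' + 1) with χ.IsPrimitive,
          ∑ ρ ∈ Z (q' + 1) χ with α ≤ ρ.re, (DirichletDisc.zeroOrder χ ρ : ℝ) ≤
            C_D * P ^ (c_D * (1 - α)))
    (hDHζ : ∀ P : ℝ, 2 ≤ P → ∀ (r : ℕ) [NeZero r] (χe : DirichletCharacter ℂ r) (β : ℝ),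
      IsExceptionalZero cH P r χe β → ∀ α : ℝ, 0 ≤ α → α ≤ 1 →
        ∑ ρ ∈ (weilZeroIndex_finite (P ^ 6)).toFinset with α ≤ ρ.re,
          ((riemannZetaZeroOrder ρ : ℤ) : ℝ) ≤ C_D * ((1 - β) * Real.log P) * P ^ (c_D * (1 - α)))
    (hDH : ∀ P : ℝ, 2 ≤ P → ∀ (r : ℕ) [NeZero r] (χe : DirichletCharacter ℂ r) (β : ℝ),
      IsExceptionalZero cH P r χe β → ∀ Z : (q : ℕ) → DirichletCharacter ℂ q → Finset ℂ,
      (∀ (q' : ℕ) (χ : DirichletCharacter ℂ (q' + 1)), ∀ ρ ∈ Z (q' + 1) χ,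
          χ.LFunction ρ = 0 ∧ 0 < ρ.re ∧ ρ.re < 1 ∧ |ρ.im| ≤ P ^ 6) →
      ∀ α : ℝ, 0 ≤ α → α ≤ 1 →
        ∑ q' ∈ Finset.Ico 1 ⌊P⌋₊, ∑ χ : DirichletCharacter ℂ (q' + 1) with χ.IsPrimitive,
          ∑ ρ ∈ Z (q' + 1) χ with (α ≤ ρ.re ∧
              ¬ (q' + 1 = r ∧ (∀ n : ℕ, χ (n : ZMod (q' + 1)) = χe (n : ZMod r)) ∧
                ρ = ((β : ℝ) : ℂ))),
            (DirichletDisc.zeroOrder χ ρ : ℝ) ≤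
            C_D * ((1 - β) * Real.log P) * P ^ (c_D * (1 - α))) :
    lemma43_gallagher := by
  obtain ⟨c, hc, h⟩ := lemma43At_of_explicitFormula_of_density hEF hEFζ hcD hCD hcH hZDζ hZD hDHζ hDH
  exact lemma43_gallagher_iff.mpr ⟨c, hc, h c hc le_rfl⟩

open scoped Classical in
/-- **(8.3) of Montgomery–Vaughan 1975** (the named fact `majorArc_lowerBound`) FOLLOWS from the
explicit formulae, the log-free density hypotheses and the §6 formulae at one level `c₁ > 0`
(conditional theorem). [cite: MontgomeryVaughanActa1975, §8 (8.3)] -/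
theorem majorArc_lowerBound_of_explicitFormula_of_density
    (hEF : truncatedExplicitFormula_psiChar) (hEFζ : truncatedExplicitFormula_psi)
    {c_D C_D cH : ℝ} (hcD : 0 < c_D) (hCD : 0 < C_D) (hcH : 0 < cH)
    (hZDζ : ∀ P : ℝ, 2 ≤ P → ∀ α : ℝ, 0 ≤ α → α ≤ 1 →
      ∑ ρ ∈ (weilZeroIndex_finite (P ^ 6)).toFinset with α ≤ ρ.re,
        ((riemannZetaZeroOrder ρ : ℤ) : ℝ) ≤ C_D * P ^ (c_D * (1 - α)))
    (hZD : ∀ P : ℝ, 2 ≤ P → ∀ Z : (q : ℕ) → DirichletCharacter ℂ q → Finset ℂ,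
      (∀ (q' : ℕ) (χ : DirichletCharacter ℂ (q' + 1)), ∀ ρ ∈ Z (q' + 1) χ,
          χ.LFunction ρ = 0 ∧ 0 < ρ.re ∧ ρ.re < 1 ∧ |ρ.im| ≤ P ^ 6) →
      ∀ α : ℝ, 0 ≤ α → α ≤ 1 →
        ∑ q' ∈ Finset.Ico 1 ⌊P⌋₊, ∑ χ : DirichletCharacter ℂ (q' + 1) with χ.IsPrimitive,
          ∑ ρ ∈ Z (q' + 1) χ with α ≤ ρ.re, (DirichletDisc.zeroOrder χ ρ : ℝ) ≤
            C_D * P ^ (c_D * (1 - α)))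
    (hDHζ : ∀ P : ℝ, 2 ≤ P → ∀ (r : ℕ) [NeZero r] (χe : DirichletCharacter ℂ r) (β : ℝ),
      IsExceptionalZero cH P r χe β → ∀ α : ℝ, 0 ≤ α → α ≤ 1 →
        ∑ ρ ∈ (weilZeroIndex_finite (P ^ 6)).toFinset with α ≤ ρ.re,
          ((riemannZetaZeroOrder ρ : ℤ) : ℝ) ≤ C_D * ((1 - β) * Real.log P) * P ^ (c_D * (1 - α)))
    (hDH : ∀ P : ℝ, 2 ≤ P → ∀ (r : ℕ) [NeZero r] (χe : DirichletCharacter ℂ r) (β : ℝ),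
      IsExceptionalZero cH P r χe β → ∀ Z : (q : ℕ) → DirichletCharacter ℂ q → Finset ℂ,
      (∀ (q' : ℕ) (χ : DirichletCharacter ℂ (q' + 1)), ∀ ρ ∈ Z (q' + 1) χ,
          χ.LFunction ρ = 0 ∧ 0 < ρ.re ∧ ρ.re < 1 ∧ |ρ.im| ≤ P ^ 6) →
      ∀ α : ℝ, 0 ≤ α → α ≤ 1 →
        ∑ q' ∈ Finset.Ico 1 ⌊P⌋₊, ∑ χ : DirichletCharacter ℂ (q' + 1) with χ.IsPrimitive,
          ∑ ρ ∈ Z (q' + 1) χ with (α ≤ ρ.re ∧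
              ¬ (q' + 1 = r ∧ (∀ n : ℕ, χ (n : ZMod (q' + 1)) = χe (n : ZMod r)) ∧
                ρ = ((β : ℝ) : ℂ))),
            (DirichletDisc.zeroOrder χ ρ : ℝ) ≤
            C_D * ((1 - β) * Real.log P) * P ^ (c_D * (1 - α)))
    (h6 : ∃ c₁ : ℝ, 0 < c₁ ∧ section6_formulae c₁) : majorArc_lowerBound :=
  majorArc_lowerBound_of_lemma43_gallagher
    (lemma43_gallagher_of_explicitFormula_of_density hEF hEFζ hcD hCD hcH hZDζ hZD hDHζ hDH) h6

open scoped Classical in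
/-- **Theorem 1 of Montgomery–Vaughan 1975** (parity.S15,
`Literature.NumberTheory.Sieve.goldbachExceptionalCount_isBigO_rpow`) FOLLOWS from the same inputs
(conditional theorem). [cite: MontgomeryVaughanActa1975, Theorem 1] -/
theorem goldbachExceptionalCount_isBigO_rpow_of_explicitFormula_of_density
    (hEF : truncatedExplicitFormula_psiChar) (hEFζ : truncatedExplicitFormula_psi)
    {c_D C_D cH : ℝ} (hcD : 0 < c_D) (hCD : 0 < C_D) (hcH : 0 < cH)
    (hZDζ : ∀ P : ℝ, 2 ≤ P → ∀ α : ℝ, 0 ≤ α → α ≤ 1 →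
      ∑ ρ ∈ (weilZeroIndex_finite (P ^ 6)).toFinset with α ≤ ρ.re,
        ((riemannZetaZeroOrder ρ : ℤ) : ℝ) ≤ C_D * P ^ (c_D * (1 - α)))
    (hZD : ∀ P : ℝ, 2 ≤ P → ∀ Z : (q : ℕ) → DirichletCharacter ℂ q → Finset ℂ,
      (∀ (q' : ℕ) (χ : DirichletCharacter ℂ (q' + 1)), ∀ ρ ∈ Z (q' + 1) χ,
          χ.LFunction ρ = 0 ∧ 0 < ρ.re ∧ ρ.re < 1 ∧ |ρ.im| ≤ P ^ 6) →
      ∀ α : ℝ, 0 ≤ α → α ≤ 1 →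
        ∑ q' ∈ Finset.Ico 1 ⌊P⌋₊, ∑ χ : DirichletCharacter ℂ (q' + 1) with χ.IsPrimitive,
          ∑ ρ ∈ Z (q' + 1) χ with α ≤ ρ.re, (DirichletDisc.zeroOrder χ ρ : ℝ) ≤
            C_D * P ^ (c_D * (1 - α)))
    (hDHζ : ∀ P : ℝ, 2 ≤ P → ∀ (r : ℕ) [NeZero r] (χe : DirichletCharacter ℂ r) (β : ℝ),
      IsExceptionalZero cH P r χe β → ∀ α : ℝ, 0 ≤ α → α ≤ 1 →
        ∑ ρ ∈ (weilZeroIndex_finite (P ^ 6)).toFinset with α ≤ ρ.re,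
          ((riemannZetaZeroOrder ρ : ℤ) : ℝ) ≤ C_D * ((1 - β) * Real.log P) * P ^ (c_D * (1 - α)))
    (hDH : ∀ P : ℝ, 2 ≤ P → ∀ (r : ℕ) [NeZero r] (χe : DirichletCharacter ℂ r) (β : ℝ),
      IsExceptionalZero cH P r χe β → ∀ Z : (q : ℕ) → DirichletCharacter ℂ q → Finset ℂ,
      (∀ (q' : ℕ) (χ : DirichletCharacter ℂ (q' + 1)), ∀ ρ ∈ Z (q' + 1) χ,
          χ.LFunction ρ = 0 ∧ 0 < ρ.re ∧ ρ.re < 1 ∧ |ρ.im| ≤ P ^ 6) →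
      ∀ α : ℝ, 0 ≤ α → α ≤ 1 →
        ∑ q' ∈ Finset.Ico 1 ⌊P⌋₊, ∑ χ : DirichletCharacter ℂ (q' + 1) with χ.IsPrimitive,
          ∑ ρ ∈ Z (q' + 1) χ with (α ≤ ρ.re ∧
              ¬ (q' + 1 = r ∧ (∀ n : ℕ, χ (n : ZMod (q' + 1)) = χe (n : ZMod r)) ∧
                ρ = ((β : ℝ) : ℂ))),
            (DirichletDisc.zeroOrder χ ρ : ℝ) ≤
            C_D * ((1 - β) * Real.log P) * P ^ (c_D * (1 - α)))
    (h6 : ∃ c₁ : ℝ, 0 < c₁ ∧ section6_formulae c₁) :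
    Literature.NumberTheory.Sieve.goldbachExceptionalCount_isBigO_rpow :=
  Literature.NumberTheory.Sieve.goldbachExceptionalCount_isBigO_rpow_of_lemma43_gallagher
    (lemma43_gallagher_of_explicitFormula_of_density hEF hEFζ hcD hCD hcH hZDζ hZD hDHζ hDH) h6

end Literature.NumberTheory.Sieve.MontgomeryVaughan1975
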